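import Summits.HubbardSuperconductivity.HubbardSuperconductivity.Theorems.AnisotropyChordTransferFibre3FinX3Eval

/-!
# Route `AnisotropyChord` / H0 rotor rung: FIN per-`L` GM₃ (X5), `L = 32` — rows `N₁` / D / side-condition cell facts, part `p57`

Kernel facts (`decide +kernel`) for cert cells 134, 135 of the per-`L` grid of `L = 32`: `xbnCellAny2` (row `N₁` on XB2 point wedges recomputed in the kernel, exporting the literal brackets `nt ⊇ T⁺ − 3λ₂` and `tb ⊇ T⁺·D`), `xdCellAnyN0` (row D, reads `nt`), `sdCellAnyZN` (side condition, reads `nt`); evaluators `…FinX3Eval` / `…FinX5Eval`; constants from the compiled design probe (x3probe/x3plan, margins c ×0.985, b ×1.03, aD ×1.03); assembled in `…FinX5GM3ThirtyTwo`.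
Prover seat `hubbard-h0-rotor-p3` g8; helper for piece A = stmt-HubbardSuperconductivity-23918 of rung 19089 (`--supports`, helper class).
WHAT THIS IS NOT: nothing here proves superconductivity in the Hubbard model (rotor TARGET as worded stays FALSE, g15 verdict); kernel facts for the FIN certificate of ONE conditional reduction.  Tree imports only; zero data; standard axioms.
-/

set_option linter.dupNamespace false
set_option autoImplicit false

namespace Summit.HubbardSuperconductivity.HubbardSuperconductivity.Theorems.AnisotropyChord.Transfer.Fibre3

namespace FinXD

open FinXB FinCell Hole2

set_option maxHeartbeats 4000000 in
/-- row `N₁` of cell 134 of `L = 32` (`c = 113/200`), exporting `nt`, `tb`. [folklore] -/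
theorem xn32_134 : xbnCellAny2 32 (49/50 : ℚ) 1392683215303696 1427500295686289 (113/200 : ℚ) ((32295646790419 : ℤ), (46733793787520 : ℤ)) ((4210319791910211 : ℤ), (4329260181637683 : ℤ)) = true := by decide +kernel

set_option maxHeartbeats 4000000 in
/-- row D of cell 134 of `L = 32` (`aD = 39/500`). [folklore] -/
theorem xd32_134 : xdCellAnyN0 32 (49/50 : ℚ) 1392683215303696 1427500295686289 (39/500 : ℚ) ((32295646790419 : ℤ), (46733793787520 : ℤ)) = true := by decide +kernel

set_option maxHeartbeats 4000000 in
/-- side condition of cell 134 of `L = 32` (`c, b = 125/100, aD`). [folklore] -/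
theorem sd32_134 : sdCellAnyZN 32 (49/50 : ℚ) 100 1392683215303696 1427500295686289 ((113/200 : ℚ), (125 : ℕ), (39/500 : ℚ)) ((32295646790419 : ℤ), (46733793787520 : ℤ)) = true := by decide +kernel

set_option maxHeartbeats 4000000 in
/-- row `N₁` of cell 135 of `L = 32` (`c = 113/200`), exporting `nt`, `tb`. [folklore] -/
theorem xn32_135 : xbnCellAny2 32 (49/50 : ℚ) 1427500295686289 1463187803078447 (113/200 : ℚ) ((34519737043362 : ℤ), (50064690159642 : ℤ)) ((4316994485791150 : ℤ), (4439654237706062 : ℤ)) = true := by decide +kernel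

set_option maxHeartbeats 4000000 in
/-- row D of cell 135 of `L = 32` (`aD = 39/500`). [folklore] -/
theorem xd32_135 : xdCellAnyN0 32 (49/50 : ℚ) 1427500295686289 1463187803078447 (39/500 : ℚ) ((34519737043362 : ℤ), (50064690159642 : ℤ)) = true := by decide +kernel

set_option maxHeartbeats 4000000 in
/-- side condition of cell 135 of `L = 32` (`c, b = 128/100, aD`). [folklore] -/
theorem sd32_135 : sdCellAnyZN 32 (49/50 : ℚ) 100 1427500295686289 1463187803078447 ((113/200 : ℚ), (128 : ℕ), (39/500 : ℚ)) ((34519737043362 : ℤ), (50064690159642 : ℤ)) = true := by decide +kernel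

end FinXD

end Summit.HubbardSuperconductivity.HubbardSuperconductivity.Theorems.AnisotropyChord.Transfer.Fibre3
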